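import Mathlib.Analysis.SpecialFunctions.Gaussian.GaussianIntegral
import Mathlib.Analysis.Complex.RealDeriv
import HarnessLib

/-!
# Smoothness, weighted integrability and decay of the Gaussian test function

Stub `stub_gaussDecay` of the line "Sketch (heat cone)" for the crux
`Summit.RiemannHypothesis.RiemannHypothesis.Theses.RuelleBand.ExactFirstBand`: the Gaussian test
function `g_u(t) = (4πu)^{-1/2} e^{-t²/(4u)}` (`u > 0`), written verbatim as
`fun t : ℝ => ((Real.exp (-(t ^ 2) / (4 * u)) / Real.sqrt (4 * Real.pi * u) : ℝ) : ℂ)`, satisfies the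
hypotheses of the cut-off explicit formula: it is smooth, `|g_u|, |g_u'|, |g_u''|` are integrable
against the weight `e^{|t|/2}`, and `|g_u(t)| ≤ C e^{-|t|}`.

The derivatives are `g_u'(t) = -(t/(2u)) g_u(t)` and `g_u''(t) = (t²/(4u²) - 1/(2u)) g_u(t)`; the
weight is absorbed by `e^{-t²/(4u)} e^{|t|/2} ≤ e^{u/2} e^{-t²/(8u)}` and the decay follows from
`e^{-t²/(4u)} ≤ e^{u} e^{-|t|}` (both are `4u|t| ≤ t² + 4u²`, i.e. `(|t| - 2u)² ≥ 0`), which reduces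
everything to the Mathlib Gaussian integrability lemmas `integrable_exp_neg_mul_sq`,
`integrable_mul_exp_neg_mul_sq`, `integrable_rpow_mul_exp_neg_mul_sq`.
-/

set_option linter.dupNamespace false

noncomputable section

open Complex MeasureTheory Filter Set
open scoped ContDiff

namespace Summit.RiemannHypothesis.RiemannHypothesis.Theorems.RuelleBandExactFirstBand

/-- AM–GM in the form used twice below: `4u|t| ≤ t² + 4u²`. -/
theorem stub_gaussDecay_key (u t : ℝ) : |t| * (4 * u) ≤ t ^ 2 + 4 * u ^ 2 := by
  nlinarith [sq_nonneg (|t| - 2 * u), sq_abs t]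

/-- Weight absorption: `e^{-t²/(4u)} e^{|t|/2} ≤ e^{u/2} e^{-(1/(8u)) t²}` for `u > 0`. -/
theorem stub_gaussDecay_weight {u : ℝ} (hu : 0 < u) (t : ℝ) :
    Real.exp (-(t ^ 2) / (4 * u)) * Real.exp (|t| / 2) ≤
      Real.exp (u / 2) * Real.exp (-(1 / (8 * u)) * t ^ 2) := by
  rw [← Real.exp_add, ← Real.exp_add, Real.exp_le_exp]
  have h1 := stub_gaussDecay_key u t
  have h2 : |t| / 2 - u / 2 ≤ t ^ 2 / (8 * u) := by
    rw [le_div_iff₀ (by positivity)]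
    nlinarith [h1]
  have h3 : -(t ^ 2) / (4 * u) = -(1 / (8 * u)) * t ^ 2 - t ^ 2 / (8 * u) := by ring
  linarith [h2, h3]

/-- Decay: `e^{-t²/(4u)} ≤ e^{u} e^{-|t|}` for `u > 0`. -/
theorem stub_gaussDecay_exp_le {u : ℝ} (hu : 0 < u) (t : ℝ) :
    Real.exp (-(t ^ 2) / (4 * u)) ≤ Real.exp u * Real.exp (-|t|) := by
  rw [← Real.exp_add, Real.exp_le_exp]
  have h1 := stub_gaussDecay_key u t
  have h2 : |t| - u ≤ t ^ 2 / (4 * u) := by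
    rw [le_div_iff₀ (by positivity)]
    nlinarith [h1]
  have h3 : -(t ^ 2) / (4 * u) = -(t ^ 2 / (4 * u)) := by ring
  linarith [h2, h3]

/-- Derivative of the Gaussian factor: `(e^{-t²/(4u)})' = -(t/(2u)) e^{-t²/(4u)}`. -/
theorem stub_gaussDecay_hasDerivAt_exp (u t : ℝ) :
    HasDerivAt (fun t : ℝ => Real.exp (-(t ^ 2) / (4 * u)))
      (-(t / (2 * u)) * Real.exp (-(t ^ 2) / (4 * u))) t := by
  convert (((hasDerivAt_pow 2 t).fun_neg).div_const (4 * u)).exp using 1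
  norm_num
  ring

/-- Derivative of the Gaussian test function (as a map `ℝ → ℂ`):
`g_u'(t) = -(t/(2u)) g_u(t)`. -/
theorem stub_gaussDecay_hasDerivAt (u t : ℝ) :
    HasDerivAt
      (fun t : ℝ => ((Real.exp (-(t ^ 2) / (4 * u)) / Real.sqrt (4 * Real.pi * u) : ℝ) : ℂ))
      ((-(t / (2 * u)) * (Real.exp (-(t ^ 2) / (4 * u)) / Real.sqrt (4 * Real.pi * u)) : ℝ) : ℂ)
      t := by
  have h := ((stub_gaussDecay_hasDerivAt_exp u t).div_const
    (Real.sqrt (4 * Real.pi * u))).ofReal_comp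
  convert h using 2
  ring

/-- Closed form of the first derivative of the Gaussian test function. -/
theorem stub_gaussDecay_deriv (u : ℝ) :
    deriv (fun t : ℝ => ((Real.exp (-(t ^ 2) / (4 * u)) / Real.sqrt (4 * Real.pi * u) : ℝ) : ℂ)) =
      fun t : ℝ =>
        ((-(t / (2 * u)) * (Real.exp (-(t ^ 2) / (4 * u)) / Real.sqrt (4 * Real.pi * u)) : ℝ) : ℂ) :=
  funext fun t => (stub_gaussDecay_hasDerivAt u t).deriv

/-- Derivative of `g_u'`: `g_u''(t) = (t²/(4u²) - 1/(2u)) g_u(t)`. -/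
theorem stub_gaussDecay_hasDerivAt_deriv (u t : ℝ) :
    HasDerivAt
      (fun t : ℝ =>
        ((-(t / (2 * u)) * (Real.exp (-(t ^ 2) / (4 * u)) / Real.sqrt (4 * Real.pi * u)) : ℝ) : ℂ))
      (((t ^ 2 / (4 * u ^ 2) - 1 / (2 * u)) *
          (Real.exp (-(t ^ 2) / (4 * u)) / Real.sqrt (4 * Real.pi * u)) : ℝ) : ℂ)
      t := by
  have h := ((((hasDerivAt_id' t).div_const (2 * u)).fun_neg).fun_mul
    ((stub_gaussDecay_hasDerivAt_exp u t).div_const (Real.sqrt (4 * Real.pi * u)))).ofReal_comp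
  convert h using 2
  ring

/-- Closed form of the second derivative of the Gaussian test function. -/
theorem stub_gaussDecay_deriv_deriv (u : ℝ) :
    deriv (deriv
        (fun t : ℝ => ((Real.exp (-(t ^ 2) / (4 * u)) / Real.sqrt (4 * Real.pi * u) : ℝ) : ℂ))) =
      fun t : ℝ =>
        (((t ^ 2 / (4 * u ^ 2) - 1 / (2 * u)) *
            (Real.exp (-(t ^ 2) / (4 * u)) / Real.sqrt (4 * Real.pi * u)) : ℝ) : ℂ) := by
  rw [stub_gaussDecay_deriv]
  exact funext fun t => (stub_gaussDecay_hasDerivAt_deriv u t).deriv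

/-- Weighted integrability of `p · g_u · e^{|t|/2}` from a Gaussian majorant: if `F` is continuous
and `‖F t‖ ≤ G t` with `G` integrable then `F` is integrable (wrapper around `Integrable.mono'`). -/
theorem stub_gaussDecay_integrable_of_le {F G : ℝ → ℝ} (hF : Continuous F) (hG : Integrable G)
    (h : ∀ t, ‖F t‖ ≤ G t) : Integrable F :=
  hG.mono' hF.aestronglyMeasurable (Eventually.of_forall h)

/-- **Stub E (M) — the Gaussian satisfies the hypotheses of the cut-off explicit formula.**
For `u > 0` the test function `g_u(t) = (4πu)^{-1/2} e^{-t²/(4u)}` is smooth, the three functions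
`|g_u| e^{|t|/2}`, `|g_u'| e^{|t|/2}`, `|g_u''| e^{|t|/2}` are integrable on `ℝ`, and
`|g_u(t)| ≤ C e^{-|t|}` with `C = e^{u}/√(4πu)`. -/
theorem stub_gaussDecay :
    ∀ u : ℝ, 0 < u →
      ContDiff ℝ ∞ (fun t : ℝ => ((Real.exp (-(t ^ 2) / (4 * u)) / Real.sqrt (4 * Real.pi * u) : ℝ) : ℂ)) ∧
      Integrable (fun t : ℝ =>
        ‖(fun t : ℝ => ((Real.exp (-(t ^ 2) / (4 * u)) / Real.sqrt (4 * Real.pi * u) : ℝ) : ℂ)) t‖ *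
          Real.exp (|t| / 2)) ∧
      Integrable (fun t : ℝ =>
        ‖deriv (fun t : ℝ => ((Real.exp (-(t ^ 2) / (4 * u)) / Real.sqrt (4 * Real.pi * u) : ℝ) : ℂ)) t‖ *
          Real.exp (|t| / 2)) ∧
      Integrable (fun t : ℝ =>
        ‖deriv (deriv (fun t : ℝ =>
            ((Real.exp (-(t ^ 2) / (4 * u)) / Real.sqrt (4 * Real.pi * u) : ℝ) : ℂ))) t‖ *
          Real.exp (|t| / 2)) ∧
      ∃ C : ℝ, ∀ t : ℝ,
        ‖(fun t : ℝ => ((Real.exp (-(t ^ 2) / (4 * u)) / Real.sqrt (4 * Real.pi * u) : ℝ) : ℂ)) t‖ ≤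
          C * Real.exp (-|t|) := by
  intro u hu
  have hS : 0 < Real.sqrt (4 * Real.pi * u) := Real.sqrt_pos.2 (by positivity)
  have hb : 0 < 1 / (8 * u) := by positivity
  set E : ℝ → ℝ := fun t => Real.exp (-(t ^ 2) / (4 * u)) / Real.sqrt (4 * Real.pi * u) with hE_def
  have hE : ∀ t, 0 < E t := fun t => div_pos (Real.exp_pos _) hS
  have hEc : Continuous E := by
    rw [hE_def]
    fun_prop
  -- the weighted Gaussian bound `E t * e^{|t|/2} ≤ K₀ e^{-b t²}`
  have hEw : ∀ t, E t * Real.exp (|t| / 2) ≤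
      Real.exp (u / 2) / Real.sqrt (4 * Real.pi * u) * Real.exp (-(1 / (8 * u)) * t ^ 2) := by
    intro t
    have h := stub_gaussDecay_weight hu t
    calc E t * Real.exp (|t| / 2)
        = Real.exp (-(t ^ 2) / (4 * u)) * Real.exp (|t| / 2) / Real.sqrt (4 * Real.pi * u) := by
          rw [hE_def]; ring
      _ ≤ Real.exp (u / 2) * Real.exp (-(1 / (8 * u)) * t ^ 2) / Real.sqrt (4 * Real.pi * u) :=
          div_le_div_of_nonneg_right h hS.le
      _ = _ := by ring
  have hG0 : Integrable (fun t : ℝ =>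
      Real.exp (u / 2) / Real.sqrt (4 * Real.pi * u) * Real.exp (-(1 / (8 * u)) * t ^ 2)) :=
    (integrable_exp_neg_mul_sq hb).const_mul _
  have hG1 : Integrable (fun t : ℝ => ‖t * Real.exp (-(1 / (8 * u)) * t ^ 2)‖) :=
    (integrable_mul_exp_neg_mul_sq hb).norm
  have hG2 : Integrable (fun t : ℝ => t ^ 2 * Real.exp (-(1 / (8 * u)) * t ^ 2)) := by
    have h := integrable_rpow_mul_exp_neg_mul_sq hb (s := 2) (by norm_num)
    simp_rw [Real.rpow_two] at h
    exact h
  have hcd : ContDiff ℝ ∞ E := by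
    rw [hE_def]
    fun_prop
  refine ⟨ofRealCLM.contDiff.comp hcd, ?_, ?_, ?_, ?_⟩
  · -- `|g_u| e^{|t|/2}`
    refine stub_gaussDecay_integrable_of_le (by fun_prop) hG0 fun t => ?_
    rw [Real.norm_eq_abs, abs_of_nonneg (by positivity), Complex.norm_of_nonneg (hE t).le]
    exact hEw t
  · -- `|g_u'| e^{|t|/2}`
    rw [stub_gaussDecay_deriv]
    refine stub_gaussDecay_integrable_of_le (by fun_prop) (hG1.const_mul
      (1 / (2 * u) * (Real.exp (u / 2) / Real.sqrt (4 * Real.pi * u)))) fun t => ?_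
    rw [Real.norm_eq_abs, abs_of_nonneg (by positivity), Complex.norm_real, Real.norm_eq_abs,
      abs_mul, abs_neg, abs_div, abs_of_pos (by positivity : (0 : ℝ) < 2 * u),
      abs_of_pos (hE t), Real.norm_eq_abs, abs_mul, abs_of_pos (Real.exp_pos _)]
    calc |t| / (2 * u) * E t * Real.exp (|t| / 2)
        = |t| / (2 * u) * (E t * Real.exp (|t| / 2)) := by ring
      _ ≤ |t| / (2 * u) *
          (Real.exp (u / 2) / Real.sqrt (4 * Real.pi * u) * Real.exp (-(1 / (8 * u)) * t ^ 2)) :=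
          mul_le_mul_of_nonneg_left (hEw t) (by positivity)
      _ = _ := by ring
  · -- `|g_u''| e^{|t|/2}`
    rw [stub_gaussDecay_deriv_deriv]
    refine stub_gaussDecay_integrable_of_le (by fun_prop)
      ((hG2.const_mul (1 / (4 * u ^ 2) * (Real.exp (u / 2) / Real.sqrt (4 * Real.pi * u)))).add
        (hG0.const_mul (1 / (2 * u)))) fun t => ?_
    rw [Real.norm_eq_abs, abs_of_nonneg (by positivity), Complex.norm_real, Real.norm_eq_abs,
      abs_mul, abs_of_pos (hE t)]
    have habs : |t ^ 2 / (4 * u ^ 2) - 1 / (2 * u)| ≤ t ^ 2 / (4 * u ^ 2) + 1 / (2 * u) :=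
      (abs_sub _ _).trans (by rw [abs_of_nonneg (by positivity), abs_of_pos (by positivity)])
    calc |t ^ 2 / (4 * u ^ 2) - 1 / (2 * u)| * E t * Real.exp (|t| / 2)
        = |t ^ 2 / (4 * u ^ 2) - 1 / (2 * u)| * (E t * Real.exp (|t| / 2)) := by ring
      _ ≤ (t ^ 2 / (4 * u ^ 2) + 1 / (2 * u)) *
          (Real.exp (u / 2) / Real.sqrt (4 * Real.pi * u) * Real.exp (-(1 / (8 * u)) * t ^ 2)) :=
          mul_le_mul habs (hEw t) (by positivity) (by positivity)
      _ = _ := by simp only [Pi.add_apply]; ring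
  · -- decay
    refine ⟨Real.exp u / Real.sqrt (4 * Real.pi * u), fun t => ?_⟩
    rw [Complex.norm_of_nonneg (hE t).le]
    calc E t = Real.exp (-(t ^ 2) / (4 * u)) / Real.sqrt (4 * Real.pi * u) := rfl
      _ ≤ Real.exp u * Real.exp (-|t|) / Real.sqrt (4 * Real.pi * u) :=
          div_le_div_of_nonneg_right (stub_gaussDecay_exp_le hu t) hS.le
      _ = _ := by ring

end Summit.RiemannHypothesis.RiemannHypothesis.Theorems.RuelleBandExactFirstBand

end
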